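/-
Copyright (c) 2026 the pub-hodgecm-mathlib formalisation cell (harness21).  Prover seat hodgecm-mathlib-LH4-p12 (g5), Track A «(D-RAM) FOUR-FRAME», unit U2H, the (ρ2b′-X)
census road — typed bottom socket (C) (dealer WORD #30: «(C) → LH4-p04 lead + LH4-p06»), brick (C-0) «FRAME-RM AT THE CM PLACE» (LH4-p04 (g5)'s LEAD LINE #1 06:39:06Z, offered to
LH4-p05 ∕ LH4-p12).  2026-09-04.
-/
import Summits.HodgeConjecture.HodgeConjecture.Theorems.F0P3cDyRamFrameRamKAtPlace                        -- ★ p857989 (this seat, (B-0)): type-free `v_map_sub_lt_one_of_fixed`, `exists_map_ne_self_at_place`; brings ★ OfNe, ★ Liu2021 RamifiedConverse, ★ QuadraticLocalBaseChange, ★ AdicCompletionCompact, D `IsRamifiedQuadraticDatum`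
import Summits.HodgeConjecture.HodgeConjecture.Theorems.F0P3cDyRamUnramifiedQuadraticCompletionDictionary  -- ★ p857937 + ED. 2 p857979 (LH4-p10 (g3)): (S2′-E) α-keyed dictionary, type-C side `…_lt_one`
import Literature.NumberTheory.LocalFields.WildQuadraticDatumNormOneQuotient                              -- ★ `WildQuadraticDatum.v_sub_map_le_of_v_le_one` (the E-different bound on integers)
import HarnessLib

/-!
# F0 · P3c · line LH4 «(D-RAM) FOUR-FRAME» — unit U2H, leaf (ρ2b′-X), typed bottom (C): brick (C-0) — THE ONE-FIELD RamM FRAME AT THE CM PLACE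

Cell `pub/hodgecm-mathlib` (D-0151), crux H413 = `stmt-HodgeConjecture-24833` (helper lane `--supports`, count-neutral); THEOREMS ONLY (no definition, no instance, no notation, no
named fact, no `sorry`).  Socket served: (C) `SOCKET-hOCC.v1.LH4p14g4.txt` 869d0c1573ac4c3b (the RamM bottom of ★ p857960 `…TypeSplit.orderCountCensus2_of_types`), whose HEAD is
LH4-p04 (g5)'s; this file is its brick (C-0): at the RAMIFIED CM place `w ∣ v` of `L ∕ L⁺` (`he`) and the line model `M := E′_{w₁}` over `L_w` (`ρ := (c₁)_{w₁}`,
`jE := ι_{w₁} = toPlace w.1 w₁`, the involution `Θ` with `Θ ∘ jE = jE ∘ σ_w`), with the TYPE-C definer `|α − ρα| < 1` (M ∕ L_w RAMIFIED; so `|jE a| = |a|²` and `#𝓀[M] = #𝓀[L_w]`,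
LH4-p10 (g3)'s ★ (S2′-E) dictionary), produce the ONE-FIELD RamM FRAME LETTERS of the (C) head's plan (o2)–(o4)∕(c1)–(c6):

* `exists_v_sub_toPlace_lt_one` — **RESIDUE SURJECTIVITY of `jE`** (`f(w₁|w) = 1`): every integer `z` of `M` has `|z − jE a| < 1` for some integer `a` of `L_w` — the residue map of
  the local homomorphism `jE|𝒪` is an injective map between finite sets of EQUAL size (★ `natCard_residueField_eq_of_v_sub_galAdicCompletionMap_lt_one`);
* `v_sub_map_lt_one_of_ramM_at_place` — **`hΘres`**: `|z − Θz| < 1` for every integer `z` of `M` (`z ≡ jE a`, `Θ(jE a) − jE a = jE(σ_w a − a)`, `σ_w ≡ id mod 𝔪_w` at the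
  ramified `w`, ★ Liu2021) — the input of ★ p857945 `…RamMAtThirdField.exists_thirdFieldPackage_ramM` over ★ p857876;
* `exists_isRamifiedQuadraticDatum_theta` — **THE Θ-DATUM ON `M`**: for any uniformiser `ϖM` of `M` (`|ϖM| = exp(−1)`, e.g. (C)'s `ϖM := α − jE a₀`),
  `∃ dΘ, IsRamifiedQuadraticDatum Θ ϖM dΘ (2·tE)` — EVEN ORDER of Θ-fixed elements by ★ p857938 `even_order_of_fixed` at `P := ϖM·ΘϖM` (`|P| = exp(−2)`), depth `dΘ ≥ 1` because
  `ΘϖM = ϖM` would force `Θ = id` (★ `map_eq_self_of_fixed_uniformizer`) against `Θ (jE ϖ) ≠ jE ϖ`, and `|2|_M = |ϖM|^{2tE}` from the `σ_w`-datum through `|jE a| = |a|²`.  The VALUE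
  of `dΘ` (the conductor–discriminant letter `dΘ = 2g` of (C)'s (o6)) is NOT claimed here;
* `ramM_frame_at_place` — the bundle: `hσres ∧ (|jE a| = |a|²) ∧ (#𝓀[M] = #𝓀[L_w]) ∧ residue surjectivity ∧ hΘres ∧ (Θ ≠ id) ∧ ∃ dΘ, IsRamifiedQuadraticDatum Θ ϖM dΘ (2tE)`.
HONEST LABEL: HC_CM is proved only modulo the 7 printed citations (2 remaining named inputs: hLiu418 = stmt-HodgeConjecture-24832, h413 = stmt-HodgeConjecture-24833) until rung 0 closes;
socket (C) is OPEN — this brick closes no socket by itself; count-neutral.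

## References
* [Rogawski1990] J. D. Rogawski, *Automorphic Representations of Unitary Groups in Three Variables*, Ann. of Math. Stud. 123 (1990), §4.9 Lemma 4.9.3 p. 56.
* [NeukirchANT1999] J. Neukirch, *Algebraic Number Theory*, Grundlehren 322 (1999), Ch. I §9 Prop. (9.6), Ch. II §4 Prop. (4.3).
* [Serre1979] J.-P. Serre, *Local Fields*, GTM 67 (1979), Ch. I §4 Prop. 10 (totally ramified ⇔ equal residue fields).
-/

set_option autoImplicit false

noncomputable section

namespace Summit.HodgeConjecture.HodgeConjecture.Cruxes.H413.F0P3cDyRamFrameRamMAtPlace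

open NumberField IsDedekindDomain WithZero IsLocalRing
open Literature.NumberTheory.Automorphic Literature.NumberTheory.Automorphic.UnitaryGroup
open Literature.NumberTheory.Automorphic.UnitaryThreeFourFrame
open Literature.NumberTheory.LocalFields.ValuedFixedFieldRamified
open Summit.HodgeConjecture.HodgeConjecture.Cruxes.H413.F0P3cDyRamFrameRamKAtPlace
open scoped Valued

variable (L : Type) [Field L] [NumberField L] [IsCMField L] {v : HeightOneSpectrum (𝓞 ↥(maximalRealSubfield L))}
  (w : UnitaryGroup.PlacesOver L v) (hw : IsCMField.complexConj L • w.1 = w.1)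
  (E' : Type) [Field E'] [NumberField E'] [Algebra L E'] (c₁ : E' ≃ₐ[L] E') (w₁ : UnitaryGroup.PlacesOver E' w.1) (hw₁ : c₁ • w₁.1 = w₁.1)

/-! ## §1 Residue surjectivity of `jE` at a type-C (M ∕ L_w ramified) frame -/

omit [IsCMField L] in
/-- **RESIDUE SURJECTIVITY of `ι_{w₁}` when `M ∕ L_w` RAMIFIES** (type C: `|α − ρα| < 1` for the integral generator `α`): every integer `z` of `M` is within `< 1` of `ι a` for some
integer `a` of `L_w` — the residue map of the local homomorphism `ι|𝒪 : 𝒪_w → 𝒪_M` is an injective map of finite sets of equal size `#𝓀[M] = #𝓀[L_w]`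
(★ `natCard_residueField_eq_of_v_sub_galAdicCompletionMap_lt_one`), hence onto. [cite: Serre1979, Ch. I §4 Prop. 10] [cite: NeukirchANT1999, Ch. II §4 Prop. (4.3)] -/
theorem exists_v_sub_toPlace_lt_one [Algebra.IsQuadraticExtension L E'] (hc₁ : c₁ ≠ 1) {α : w₁.1.adicCompletion E'}
    (hρα : galAdicCompletionMap (L := E') c₁ hw₁ α ≠ α) (hα1 : Valued.v α ≤ 1)
    (hint : ∀ z : w₁.1.adicCompletion E', Valued.v z ≤ 1 →
      Valued.v ((z - galAdicCompletionMap (L := E') c₁ hw₁ z) / (α - galAdicCompletionMap (L := E') c₁ hw₁ α)) ≤ 1)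
    (hαC : Valued.v (α - galAdicCompletionMap (L := E') c₁ hw₁ α) < 1)
    (z : w₁.1.adicCompletion E') (hz : Valued.v z ≤ 1) :
    ∃ a : w.1.adicCompletion L, Valued.v a ≤ 1 ∧ Valued.v (z - toPlace w.1 w₁ a) < 1 := by
  classical
  haveI : Finite 𝓀[w₁.1.adicCompletion E'] := finite_residueField_adicCompletion E' w₁.1
  haveI : Finite 𝓀[w.1.adicCompletion L] := finite_residueField_adicCompletion L w.1
  have hjE2 : ∀ a, Valued.v (toPlace w.1 w₁ a) = Valued.v a ^ 2 :=
    F0P3cDyRamUnramifiedQuadraticCompletionDictionary.valued_toPlace_eq_sq_of_v_sub_galAdicCompletionMap_lt_one E' c₁ w.1 hc₁ w₁ hw₁ hρα hα1 hint hαC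
  have hcard : Nat.card 𝓀[w₁.1.adicCompletion E'] = Nat.card 𝓀[w.1.adicCompletion L] :=
    F0P3cDyRamUnramifiedQuadraticCompletionDictionary.natCard_residueField_eq_of_v_sub_galAdicCompletionMap_lt_one E' c₁ w.1 hc₁ w₁ hw₁ hρα hα1 hint hαC
  -- the local homomorphism `jE|𝒪 : 𝒪_w → 𝒪_M` and its residue map
  have hjle1 : ∀ a, Valued.v (toPlace w.1 w₁ a) ≤ 1 ↔ Valued.v a ≤ 1 := fun a => by
    rw [hjE2, pow_le_one_iff_of_nonneg zero_le two_ne_zero]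
  have hjeq1 : ∀ a, Valued.v (toPlace w.1 w₁ a) = 1 ↔ Valued.v a = 1 := fun a => by
    rw [hjE2, pow_eq_one_iff_of_nonneg zero_le two_ne_zero]
  have hOO : ∀ a : 𝒪[w.1.adicCompletion L], toPlace w.1 w₁ (a : w.1.adicCompletion L) ∈ 𝒪[w₁.1.adicCompletion E'] := fun a =>
    (Valuation.mem_integer_iff _ _).2 ((hjle1 a).2 a.2)
  let f : 𝒪[w.1.adicCompletion L] →+* 𝒪[w₁.1.adicCompletion E'] :=
    ((toPlace w.1 w₁).comp (𝒪[w.1.adicCompletion L]).subtype).codRestrict 𝒪[w₁.1.adicCompletion E'] hOO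
  haveI : IsLocalHom f := by
    refine ⟨fun a ha => ?_⟩
    rw [Valuation.Integers.isUnit_iff_valuation_eq_one (Valuation.integer.integers _)] at ha ⊢
    exact (hjeq1 a).1 ha
  let g : 𝓀[w.1.adicCompletion L] →+* 𝓀[w₁.1.adicCompletion E'] := IsLocalRing.ResidueField.map f
  have hg : Function.Bijective g := g.injective.bijective_of_nat_card_le (le_of_eq hcard)
  obtain ⟨abar, habar⟩ := hg.2 (IsLocalRing.residue _ ⟨z, hz⟩)
  obtain ⟨a, rfl⟩ := IsLocalRing.residue_surjective abar
  refine ⟨a, a.2, ?_⟩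
  have h : IsLocalRing.residue _ (f a) = IsLocalRing.residue _ ⟨z, hz⟩ := by
    rw [← IsLocalRing.ResidueField.map_residue]; exact habar
  rw [← sub_eq_zero, ← map_sub, IsLocalRing.residue_eq_zero_iff, IsLocalRing.mem_maximalIdeal, mem_nonunits_iff,
    Valuation.Integer.not_isUnit_iff_valuation_lt_one] at h
  have h' : Valued.v (toPlace w.1 w₁ (a : w.1.adicCompletion L) - z) < 1 := h
  rwa [← Valuation.map_neg, neg_sub] at h'

/-! ## §2 `hΘres` at a type-C frame -/

/-- **`hΘres` AT THE CM PLACE (type C)**: every integer `z` of `M` has `|z − Θz| < 1` — `z ≡ ι a (mod 𝔪_M)` by §1, and `Θ(ι a) − ι a = ι(σ_w a − a)` has order `> 0` because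
`σ_w ≡ id (mod 𝔪_w)` at the RAMIFIED `w` (★ Liu2021 `valued_galAdicCompletionMap_sub_lt_one_of_ramified`). [cite: NeukirchANT1999, Ch. I §9 Prop. (9.6)]
[cite: Serre1979, Ch. I §4 Prop. 10] -/
theorem v_sub_map_lt_one_of_ramM_at_place [Algebra.IsQuadraticExtension L E'] (hc₁ : c₁ ≠ 1) (he : v.asIdeal.ramificationIdx' w.1.asIdeal ≠ 1)
    (Θ : w₁.1.adicCompletion E' →+* w₁.1.adicCompletion E') {α : w₁.1.adicCompletion E'}
    (hρα : galAdicCompletionMap (L := E') c₁ hw₁ α ≠ α) (hα1 : Valued.v α ≤ 1)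
    (hint : ∀ z : w₁.1.adicCompletion E', Valued.v z ≤ 1 →
      Valued.v ((z - galAdicCompletionMap (L := E') c₁ hw₁ z) / (α - galAdicCompletionMap (L := E') c₁ hw₁ α)) ≤ 1)
    (hαC : Valued.v (α - galAdicCompletionMap (L := E') c₁ hw₁ α) < 1)
    (hΘj : ∀ a, Θ (toPlace w.1 w₁ a) = toPlace w.1 w₁ ((galAdicCompletionMap (L := L) (IsCMField.complexConj L) hw) a))
    (hvΘ : ∀ z, Valued.v (Θ z) = Valued.v z)
    (z : w₁.1.adicCompletion E') (hz : Valued.v z ≤ 1) : Valued.v (z - Θ z) < 1 := by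
  haveI : Algebra.IsQuadraticExtension ↥(maximalRealSubfield L) L := IsCMField.isQuadraticExtension L
  have hc1 : IsCMField.complexConj L ≠ 1 := IsCMField.complexConj_ne_one L
  have hjE2 : ∀ a, Valued.v (toPlace w.1 w₁ a) = Valued.v a ^ 2 :=
    F0P3cDyRamUnramifiedQuadraticCompletionDictionary.valued_toPlace_eq_sq_of_v_sub_galAdicCompletionMap_lt_one E' c₁ w.1 hc₁ w₁ hw₁ hρα hα1 hint hαC
  obtain ⟨a, ha1, hza⟩ := exists_v_sub_toPlace_lt_one L w E' c₁ w₁ hw₁ hc₁ hρα hα1 hint hαC z hz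
  have hfix : Valued.v (Θ (toPlace w.1 w₁ a) - toPlace w.1 w₁ a) < 1 := by
    rw [hΘj, ← map_sub, hjE2]
    exact pow_lt_one₀ zero_le
      (Liu2021.LemD1IndexedNonVacuityRamifiedConverse.valued_galAdicCompletionMap_sub_lt_one_of_ramified L (IsCMField.complexConj L) v hc1 w hw he a ha1)
      two_ne_zero
  have hsplit : z - Θ z = (z - toPlace w.1 w₁ a) - Θ (z - toPlace w.1 w₁ a) - (Θ (toPlace w.1 w₁ a) - toPlace w.1 w₁ a) := by
    rw [map_sub]; ring
  rw [hsplit]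
  refine Valuation.map_sub_lt _ (Valuation.map_sub_lt _ hza ?_) hfix
  rwa [hvΘ]

/-! ## §3 The Θ-datum on `M` at a type-C frame -/

/-- **THE Θ-DATUM ON `M`** at a uniformiser `ϖM` of `M` (`|ϖM| = exp(−1)`): `∃ dΘ, IsRamifiedQuadraticDatum Θ ϖM dΘ (2·tE)` — Θ is an isometric involution (frame), EVEN ORDER of
Θ-fixed elements by ★ `even_order_of_fixed` at the Θ-fixed `P := ϖM·ΘϖM` of order `2` (needs `hΘres` and `Θ ≠ id`), `1 ≤ dΘ` with `|ϖM − ΘϖM| = |ϖM|^{dΘ}` because `0 < |ϖM − ΘϖM| ≤ exp(−1)`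
(`ΘϖM = ϖM` would force `Θ = id`, ★ `map_eq_self_of_fixed_uniformizer`), and `|2|_M = |ι 2| = |2|_w² = |ϖ|^{2tE} = |ϖM|^{2tE}` from the `σ_w`-datum and `|ι a| = |a|²`.
[cite: Serre1979, Ch. I §4 Prop. 10] [cite: Rogawski1990, §4.9 Lemma 4.9.3 p. 56] -/
theorem exists_isRamifiedQuadraticDatum_theta (Θ : w₁.1.adicCompletion E' →+* w₁.1.adicCompletion E')
    (hΘΘ : ∀ z, Θ (Θ z) = z) (hvΘ : ∀ z, Valued.v (Θ z) = Valued.v z)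
    (hΘres : ∀ z : w₁.1.adicCompletion E', Valued.v z ≤ 1 → Valued.v (z - Θ z) < 1) (hΘne : ∃ x : w₁.1.adicCompletion E', Θ x ≠ x)
    (hjE2 : ∀ a, Valued.v (toPlace w.1 w₁ a) = Valued.v a ^ 2)
    {ϖ : w.1.adicCompletion L} {d tE : ℕ} (hD : IsRamifiedQuadraticDatum (galAdicCompletionMap (L := L) (IsCMField.complexConj L) hw) ϖ d tE)
    {ϖM : w₁.1.adicCompletion E'} (hϖM : Valued.v ϖM = exp (-1 : ℤ)) :
    ∃ dΘ : ℕ, IsRamifiedQuadraticDatum Θ ϖM dΘ (2 * tE) := by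
  haveI : Finite 𝓀[w₁.1.adicCompletion E'] := finite_residueField_adicCompletion E' w₁.1
  obtain ⟨-, -, hϖ, -, -, -, h2⟩ := hD
  -- the Θ-fixed `P := ϖM·ΘϖM` of order 2
  have hΘP : Θ (ϖM * Θ ϖM) = ϖM * Θ ϖM := by rw [map_mul, hΘΘ, mul_comm]
  have hP : Valued.v (ϖM * Θ ϖM) = exp (-2 : ℤ) := by rw [map_mul, hvΘ, hϖM, ← exp_add]; rfl
  -- the depth: `0 < |ϖM − ΘϖM| ≤ exp(−1)`
  have hne : ϖM - Θ ϖM ≠ 0 := by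
    intro h0
    obtain ⟨x, hx⟩ := hΘne
    exact hx (map_eq_self_of_fixed_uniformizer hΘΘ hvΘ hΘres (sub_eq_zero.1 h0).symm hϖM x)
  have hv0 : Valued.v (ϖM - Θ ϖM) ≠ 0 := (Valuation.ne_zero_iff _).2 hne
  obtain ⟨k, hk⟩ : ∃ k : ℤ, Valued.v (ϖM - Θ ϖM) = exp k := ⟨_, (exp_log hv0).symm⟩
  have hk1 : k ≤ -1 := by
    have hle : Valued.v (ϖM - Θ ϖM) < 1 := hΘres ϖM (by rw [hϖM, ← exp_zero, exp_le_exp]; norm_num)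
    have h := le_exp_sub_one_of_lt (m := 0) (by rw [exp_zero]; exact hle)
    rw [hk, exp_le_exp] at h; omega
  refine ⟨(-k).toNat, hΘΘ, hvΘ, hϖM, fun z hz hz0 => even_order_of_fixed hΘΘ hvΘ hΘres hΘne hΘP hP z hz hz0, ?_, by omega, ?_⟩
  · rw [hk, hϖM, ← exp_nsmul, nsmul_eq_mul, exp_inj]; rw [Int.toNat_of_nonneg (by omega)]; ring
  · rw [show (2 : w₁.1.adicCompletion E') = toPlace w.1 w₁ 2 from (map_ofNat _ 2).symm, hjE2, h2, hϖ, hϖM, ← pow_mul, mul_comm]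

/-! ## §4 The bundle -/

/-- **(C-0) THE ONE-FIELD RamM FRAME AT THE CM PLACE, BUNDLED**: under socket (C)'s frame letters (`ρα ≠ α`, `|α| ≤ 1`, `hint`, `|ι a| ≤ 1 ↔ |a| ≤ 1`, `Fix ρ = ι(L_w)`,
`Θ ∘ ι = ι ∘ σ_w`, `ΘΘ = 1`, `Θ` isometric, `[IsQuadraticExtension L E']`, `c₁ ≠ 1`), the type-C definer `|α − ρα| < 1`, the RAMIFIED CM place (`he`, datum `hD`) and a uniformiser `ϖM` of
`M`: **`hσres ∧ (∀ a, |ι a| = |a|²) ∧ #𝓀[M] = #𝓀[L_w] ∧ (residue surjectivity of ι) ∧ hΘres ∧ (Θ ≠ id) ∧ ∃ dΘ, IsRamifiedQuadraticDatum Θ ϖM dΘ (2·tE)`**.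
[cite: Rogawski1990, §4.9 Lemma 4.9.3 p. 56] [cite: NeukirchANT1999, Ch. I §9 Prop. (9.6), Ch. II §4 Prop. (4.3)] [cite: Serre1979, Ch. I §4 Prop. 10] -/
theorem ramM_frame_at_place [Algebra.IsQuadraticExtension L E'] (hc₁ : c₁ ≠ 1) (he : v.asIdeal.ramificationIdx' w.1.asIdeal ≠ 1)
    {ϖ : w.1.adicCompletion L} {d tE : ℕ} (hD : IsRamifiedQuadraticDatum (galAdicCompletionMap (L := L) (IsCMField.complexConj L) hw) ϖ d tE)
    (Θ : w₁.1.adicCompletion E' →+* w₁.1.adicCompletion E') {α : w₁.1.adicCompletion E'}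
    (hρα : galAdicCompletionMap (L := E') c₁ hw₁ α ≠ α) (hα1 : Valued.v α ≤ 1)
    (hint : ∀ z : w₁.1.adicCompletion E', Valued.v z ≤ 1 →
      Valued.v ((z - galAdicCompletionMap (L := E') c₁ hw₁ z) / (α - galAdicCompletionMap (L := E') c₁ hw₁ α)) ≤ 1)
    (hjle1 : ∀ a, Valued.v (toPlace w.1 w₁ a) ≤ 1 ↔ Valued.v a ≤ 1)
    (hjfix : ∀ z : w₁.1.adicCompletion E', galAdicCompletionMap (L := E') c₁ hw₁ z = z ↔ ∃ a, toPlace w.1 w₁ a = z)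
    (hΘj : ∀ a, Θ (toPlace w.1 w₁ a) = toPlace w.1 w₁ ((galAdicCompletionMap (L := L) (IsCMField.complexConj L) hw) a))
    (hΘΘ : ∀ z, Θ (Θ z) = z) (hvΘ : ∀ z, Valued.v (Θ z) = Valued.v z)
    (hαC : Valued.v (α - galAdicCompletionMap (L := E') c₁ hw₁ α) < 1)
    {ϖM : w₁.1.adicCompletion E'} (hϖM : Valued.v ϖM = exp (-1 : ℤ)) :
    (∀ z : w₁.1.adicCompletion E', galAdicCompletionMap (L := E') c₁ hw₁ z = z → Valued.v z ≤ 1 → Valued.v (Θ z - z) < 1) ∧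
    (∀ a, Valued.v (toPlace w.1 w₁ a) = Valued.v a ^ 2) ∧
    Nat.card 𝓀[w₁.1.adicCompletion E'] = Nat.card 𝓀[w.1.adicCompletion L] ∧
    (∀ z : w₁.1.adicCompletion E', Valued.v z ≤ 1 → ∃ a : w.1.adicCompletion L, Valued.v a ≤ 1 ∧ Valued.v (z - toPlace w.1 w₁ a) < 1) ∧
    (∀ z : w₁.1.adicCompletion E', Valued.v z ≤ 1 → Valued.v (z - Θ z) < 1) ∧
    (∃ x : w₁.1.adicCompletion E', Θ x ≠ x) ∧
    ∃ dΘ : ℕ, IsRamifiedQuadraticDatum Θ ϖM dΘ (2 * tE) := by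
  have hjE2 : ∀ a, Valued.v (toPlace w.1 w₁ a) = Valued.v a ^ 2 :=
    F0P3cDyRamUnramifiedQuadraticCompletionDictionary.valued_toPlace_eq_sq_of_v_sub_galAdicCompletionMap_lt_one E' c₁ w.1 hc₁ w₁ hw₁ hρα hα1 hint hαC
  have hΘres := v_sub_map_lt_one_of_ramM_at_place L w hw E' c₁ w₁ hw₁ hc₁ he Θ hρα hα1 hint hαC hΘj hvΘ
  have hΘne := exists_map_ne_self_at_place L w hw E' w₁ Θ hΘj hD
  exact ⟨v_map_sub_lt_one_of_fixed L w hw E' c₁ w₁ hw₁ he Θ hjle1 hjfix hΘj, hjE2,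
    F0P3cDyRamUnramifiedQuadraticCompletionDictionary.natCard_residueField_eq_of_v_sub_galAdicCompletionMap_lt_one E' c₁ w.1 hc₁ w₁ hw₁ hρα hα1 hint hαC,
    exists_v_sub_toPlace_lt_one L w E' c₁ w₁ hw₁ hc₁ hρα hα1 hint hαC, hΘres, hΘne,
    exists_isRamifiedQuadraticDatum_theta L w hw E' w₁ Θ hΘΘ hvΘ hΘres hΘne hjE2 hD hϖM⟩

/-! ## §5 The ρ-datum and the τ-letter at any uniformiser of `M`; the E-different bound transported (the inputs of LH4-p04 (g5)'s (o1′) and of ★ `KleinDifferentLetters`) -/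

/-- **THE ρ-DATUM ON `M` AT ANY UNIFORMISER** (type C): `∃ dρ, IsRamifiedQuadraticDatum ρ ϖM dρ (2·tE)` — ρ-fixed elements are `ι(L_w)` and `|ι a| = |a|²` is EVEN; `ρϖM ≠ ϖM`
(an odd order is not a square), so `exp(−dρ) := |ϖM − ρϖM| ≤ exp(−1)`; `|2|_M = |ϖM|^{2tE}` through `|ι 2| = |2|_w²`. [cite: Serre1979, Ch. I §4 Prop. 10] -/
theorem exists_isRamifiedQuadraticDatum_rho
    (hρρ : ∀ z, galAdicCompletionMap (L := E') c₁ hw₁ (galAdicCompletionMap (L := E') c₁ hw₁ z) = z)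
    (hvρ : ∀ z, Valued.v (galAdicCompletionMap (L := E') c₁ hw₁ z) = Valued.v z)
    (hjfix : ∀ z : w₁.1.adicCompletion E', galAdicCompletionMap (L := E') c₁ hw₁ z = z ↔ ∃ a, toPlace w.1 w₁ a = z)
    (hjE2 : ∀ a, Valued.v (toPlace w.1 w₁ a) = Valued.v a ^ 2)
    {ϖ : w.1.adicCompletion L} {d tE : ℕ} (hD : IsRamifiedQuadraticDatum (galAdicCompletionMap (L := L) (IsCMField.complexConj L) hw) ϖ d tE)
    {ϖM : w₁.1.adicCompletion E'} (hϖM : Valued.v ϖM = exp (-1 : ℤ)) :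
    ∃ dρ : ℕ, IsRamifiedQuadraticDatum (galAdicCompletionMap (L := E') c₁ hw₁) ϖM dρ (2 * tE) := by
  obtain ⟨-, -, hϖ, -, -, -, h2⟩ := hD
  set ρ := galAdicCompletionMap (L := E') c₁ hw₁ with hρdef
  -- ρ-fixed elements have even order
  have heven : ∀ z : w₁.1.adicCompletion E', ρ z = z → z ≠ 0 → ∃ n : ℤ, Valued.v z = exp (2 * n) := by
    intro z hz hz0
    obtain ⟨a, rfl⟩ := (hjfix z).1 hz
    have ha0 : Valued.v a ≠ 0 := fun h => hz0 (by rw [(Valuation.zero_iff _).1 h, map_zero])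
    obtain ⟨k, hk⟩ : ∃ k : ℤ, Valued.v a = exp k := ⟨_, (exp_log ha0).symm⟩
    exact ⟨k, by rw [hjE2, hk, ← exp_nsmul, nsmul_eq_mul]; push_cast; ring_nf⟩
  -- `ρ ϖM ≠ ϖM` and the depth
  have hne : ϖM - ρ ϖM ≠ 0 := by
    intro h0
    obtain ⟨n, hn⟩ := heven ϖM (sub_eq_zero.1 h0).symm (fun h => by rw [h, map_zero] at hϖM; exact exp_ne_zero hϖM.symm)
    rw [hϖM, exp_inj] at hn; omega
  have hv0 : Valued.v (ϖM - ρ ϖM) ≠ 0 := (Valuation.ne_zero_iff _).2 hne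
  obtain ⟨k, hk⟩ : ∃ k : ℤ, Valued.v (ϖM - ρ ϖM) = exp k := ⟨_, (exp_log hv0).symm⟩
  have hk1 : k ≤ -1 := by
    have hle : Valued.v (ϖM - ρ ϖM) ≤ exp (-1 : ℤ) :=
      (Valuation.map_sub _ _ _).trans (max_le (le_of_eq hϖM) (by rw [hvρ]; exact le_of_eq hϖM))
    rw [hk, exp_le_exp] at hle; exact hle
  refine ⟨(-k).toNat, hρρ, hvρ, hϖM, heven, ?_, by omega, ?_⟩
  · rw [hk, hϖM, ← exp_nsmul, nsmul_eq_mul, exp_inj]; rw [Int.toNat_of_nonneg (by omega)]; ring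
  · rw [show (2 : w₁.1.adicCompletion E') = toPlace w.1 w₁ 2 from (map_ofNat _ 2).symm, hjE2, h2, hϖ, hϖM, ← pow_mul, mul_comm]

/-- **THE τ-LETTER AT ANY UNIFORMISER** (type C, `τ := Θ ∘ ρ`): `∃ dτ ≥ 1, |ϖM − Θ(ρϖM)| = |ϖM|^{dτ}` — `τ` is a residually trivial isometric involution (`τ ∘ ι = ι ∘ σ_w` as for `Θ`,
§2 at `Θ ∘ ρ`), so `τϖM = ϖM` would force `τ = id` (★ `map_eq_self_of_fixed_uniformizer`) against `τ(ι ϖ) = ι(σ_w ϖ) ≠ ι ϖ`. [cite: Serre1979, Ch. I §4 Prop. 10] -/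
theorem exists_tau_depth [Algebra.IsQuadraticExtension L E'] (hc₁ : c₁ ≠ 1) (he : v.asIdeal.ramificationIdx' w.1.asIdeal ≠ 1)
    {ϖ : w.1.adicCompletion L} {d tE : ℕ} (hD : IsRamifiedQuadraticDatum (galAdicCompletionMap (L := L) (IsCMField.complexConj L) hw) ϖ d tE)
    (Θ : w₁.1.adicCompletion E' →+* w₁.1.adicCompletion E') {α : w₁.1.adicCompletion E'}
    (hρρ : ∀ z, galAdicCompletionMap (L := E') c₁ hw₁ (galAdicCompletionMap (L := E') c₁ hw₁ z) = z)
    (hvρ : ∀ z, Valued.v (galAdicCompletionMap (L := E') c₁ hw₁ z) = Valued.v z)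
    (hρα : galAdicCompletionMap (L := E') c₁ hw₁ α ≠ α) (hα1 : Valued.v α ≤ 1)
    (hint : ∀ z : w₁.1.adicCompletion E', Valued.v z ≤ 1 →
      Valued.v ((z - galAdicCompletionMap (L := E') c₁ hw₁ z) / (α - galAdicCompletionMap (L := E') c₁ hw₁ α)) ≤ 1)
    (hαC : Valued.v (α - galAdicCompletionMap (L := E') c₁ hw₁ α) < 1)
    (hjfix : ∀ z : w₁.1.adicCompletion E', galAdicCompletionMap (L := E') c₁ hw₁ z = z ↔ ∃ a, toPlace w.1 w₁ a = z)
    (hΘj : ∀ a, Θ (toPlace w.1 w₁ a) = toPlace w.1 w₁ ((galAdicCompletionMap (L := L) (IsCMField.complexConj L) hw) a))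
    (hΘΘ : ∀ z, Θ (Θ z) = z) (hΘρ : ∀ z, Θ (galAdicCompletionMap (L := E') c₁ hw₁ z) = galAdicCompletionMap (L := E') c₁ hw₁ (Θ z))
    (hvΘ : ∀ z, Valued.v (Θ z) = Valued.v z)
    {ϖM : w₁.1.adicCompletion E'} (hϖM : Valued.v ϖM = exp (-1 : ℤ)) :
    ∃ dτ : ℕ, 1 ≤ dτ ∧ Valued.v (ϖM - Θ (galAdicCompletionMap (L := E') c₁ hw₁ ϖM)) = Valued.v ϖM ^ dτ := by
  haveI : Finite 𝓀[w₁.1.adicCompletion E'] := finite_residueField_adicCompletion E' w₁.1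
  set ρ := galAdicCompletionMap (L := E') c₁ hw₁ with hρdef
  set τ : w₁.1.adicCompletion E' →+* w₁.1.adicCompletion E' := Θ.comp ρ with hτdef
  have hτj : ∀ a, τ (toPlace w.1 w₁ a) = toPlace w.1 w₁ ((galAdicCompletionMap (L := L) (IsCMField.complexConj L) hw) a) := fun a => by
    rw [hτdef, RingHom.comp_apply, (hjfix _).2 ⟨a, rfl⟩, hΘj]
  have hvτ : ∀ z, Valued.v (τ z) = Valued.v z := fun z => by rw [hτdef, RingHom.comp_apply, hvΘ, hvρ]
  have hττ : ∀ z, τ (τ z) = z := fun z => by rw [hτdef, RingHom.comp_apply, RingHom.comp_apply, ← hΘρ, hΘΘ, hρρ]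
  have hτres : ∀ z : w₁.1.adicCompletion E', Valued.v z ≤ 1 → Valued.v (z - τ z) < 1 :=
    v_sub_map_lt_one_of_ramM_at_place L w hw E' c₁ w₁ hw₁ hc₁ he τ hρα hα1 hint hαC hτj hvτ
  have hτne := exists_map_ne_self_at_place L w hw E' w₁ τ hτj hD
  have hne : ϖM - τ ϖM ≠ 0 := by
    intro h0
    obtain ⟨x, hx⟩ := hτne
    exact hx (map_eq_self_of_fixed_uniformizer hττ hvτ hτres (sub_eq_zero.1 h0).symm hϖM x)
  have hv0 : Valued.v (ϖM - τ ϖM) ≠ 0 := (Valuation.ne_zero_iff _).2 hne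
  obtain ⟨k, hk⟩ : ∃ k : ℤ, Valued.v (ϖM - τ ϖM) = exp k := ⟨_, (exp_log hv0).symm⟩
  have hk1 : k ≤ -1 := by
    have hle : Valued.v (ϖM - τ ϖM) ≤ exp (-1 : ℤ) :=
      (Valuation.map_sub _ _ _).trans (max_le (le_of_eq hϖM) (by rw [hvτ]; exact le_of_eq hϖM))
    rw [hk, exp_le_exp] at hle; exact hle
  refine ⟨(-k).toNat, by omega, ?_⟩
  have hτϖ : Θ (ρ ϖM) = τ ϖM := rfl
  rw [hτϖ, hk, hϖM, ← exp_nsmul, nsmul_eq_mul, exp_inj]; rw [Int.toNat_of_nonneg (by omega)]; ring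

omit [IsCMField L] in
/-- **THE E-DIFFERENT BOUND TRANSPORTED**: for a `ρ`-fixed integer `z = ι a` of `M`, `|z − Θz| = |ι(a − σ_w a)| ≤ |ι ϖ|^d` — ★ `WildQuadraticDatum.v_sub_map_le_of_v_le_one` on `L_w`
through `|ι x| = |x|^e` (any exponent `e`: `e = 1` at type B, `e = 2` at type C). [cite: Serre1979, Ch. I §4 Prop. 10] -/
theorem v_sub_map_le_of_fixed_at_place {σw : w.1.adicCompletion L →+* w.1.adicCompletion L}
    (Θ : w₁.1.adicCompletion E' →+* w₁.1.adicCompletion E') {e : ℕ}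
    (hjEe : ∀ a, Valued.v (toPlace w.1 w₁ a) = Valued.v a ^ e)
    (hjfix : ∀ z : w₁.1.adicCompletion E', galAdicCompletionMap (L := E') c₁ hw₁ z = z ↔ ∃ a, toPlace w.1 w₁ a = z)
    (hΘj : ∀ a, Θ (toPlace w.1 w₁ a) = toPlace w.1 w₁ (σw a))
    {ϖ : w.1.adicCompletion L} {d tE : ℕ} (hD : IsRamifiedQuadraticDatum σw ϖ d tE)
    (z : w₁.1.adicCompletion E') (hz : galAdicCompletionMap (L := E') c₁ hw₁ z = z) (hz1 : Valued.v z ≤ 1) :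
    Valued.v (z - Θ z) ≤ Valued.v (toPlace w.1 w₁ ϖ) ^ d := by
  obtain ⟨hσσ, -, hϖ, hfix, hdd, -, -⟩ := hD
  obtain ⟨a, rfl⟩ := (hjfix z).1 hz
  have he0 : e ≠ 0 := by
    rintro rfl
    have h := hjEe 0
    rw [map_zero, map_zero, pow_zero] at h
    exact zero_ne_one h
  have ha1 : Valued.v a ≤ 1 := by
    have h := hz1
    rw [hjEe] at h
    exact (pow_le_one_iff_of_nonneg zero_le he0).1 h
  rw [hΘj, ← map_sub, hjEe, hjEe, ← pow_mul, mul_comm, pow_mul]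
  exact pow_le_pow_left₀ zero_le (Literature.NumberTheory.LocalFields.WildQuadraticDatum.v_sub_map_le_of_v_le_one hσσ hfix hϖ hdd ha1) e

end Summit.HodgeConjecture.HodgeConjecture.Cruxes.H413.F0P3cDyRamFrameRamMAtPlace

end
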